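import Summits.Ventures.CertifiedArithmetic.LowPrec.AccumulateHeight
import Summits.Ventures.CertifiedArithmetic.LowPrec.AccumulateDirected

/-!
# The Lange–Rump height bound for ANY rounding into a format (faithful / directed: `2h·u`)

HONEST FRAMING (venture CertifiedArithmetic / cell `pub-lowprec`): certified error envelopes and
provably optimal rounding/accumulation schemes for low-precision formats under stated cost models;
every table by two implementations; no hardware or vendor claims.

[LangeRump2018, Prop 3] (quoted as [BoldoEtAl2023, Thm 4.4]) has a second half: "if one
substitutes `2u` for `u` in the height restriction as well as in the bound, the result remains
valid for any faithful-addition": height `h ≤ (2u)^{-1/2} - 1` ⟹ `|ŝ - s| ≤ 2h·u·Σ|xᵢ|`.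
`AccumulateHeight.lean` proved the round-to-nearest half. Here the paper's Theorem 7 induction is
run ONCE for an arbitrary node map `fl : ℚ → ℚ` landing in `F_α` whose in-range additions err by
at most `c · ufpN(argument)` (`langeRump_height_induction_with`; `c = u` for `roundNE`, `c = 2u`
for any faithful rounding), giving `Σ|e_v| ≤ h·c·Σ|xᵢ|` whenever `(h+1)²·c ≤ 1`
(`absErr_le_height_with`). Instances: the directed roundings of `Directed.lean` —
`abs_eval_rd_sub_exact_le_height`, `abs_eval_ru_sub_exact_le_height` (round-down / round-up,
any order, `(h+1)²·2u ≤ 1` ⟹ `|ŝ - s| ≤ 2h·u·Σ|xᵢ|`; new for RD/RU — for RZ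
`AccumulateDirected.lean` has `2u·h` with NO height restriction because truncation never
increases a magnitude), and ANY FAITHFUL SELECTION `fl t ∈ {RD t, RU t}`
(`abs_eval_faithful_sub_exact_le_height`), e.g. a realisation of stochastic rounding viewed as a
map. Range hypothesis: every node's exact argument within `±maxRat` (`TreeInRangeWith`).
-/

namespace Literature.ComputerArithmetic.FloatingPoint

namespace MiniFloat

open Literature.ComputerArithmetic.JeannerodRump2018
open Literature.ComputerArithmetic.JeannerodRump2018.SumTree

variable {α : Format}

/-! ### Trees evaluated with an arbitrary rounding map -/

/-- In-range evaluation with a general node map `fl`: leaves are values of `α`, every node's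
exact argument is within `±maxRat`. [folklore] -/
def TreeInRangeWith (α : Format) (fl : ℚ → ℚ) : SumTree → Prop
  | .leaf x => ∃ y : MiniFloat α, y.toRat = x
  | .node l r => TreeInRangeWith α fl l ∧ TreeInRangeWith α fl r ∧
      |SumTree.eval fl l + SumTree.eval fl r| ≤ α.maxRat

/-- With a map landing in `F_α`, every evaluated subtree is a value of `α`. [folklore] -/
theorem exists_toRat_eq_eval_with {fl : ℚ → ℚ} (hval : ∀ t : ℚ, ∃ y : MiniFloat α, y.toRat = fl t) :
    ∀ t : SumTree, TreeInRangeWith α fl t → ∃ y : MiniFloat α, y.toRat = SumTree.eval fl t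
  | .leaf _, h => h
  | .node _ _, _ => hval _

/-- The root's exact argument under `fl` (`0` for a leaf). [cite: LangeRump2018, Thm 7] -/
def rootArgWith (fl : ℚ → ℚ) : SumTree → ℚ
  | .leaf _ => 0
  | .node l r => SumTree.eval fl l + SumTree.eval fl r

/-- TWO-LEVEL BOUND for a general rounding with local constant `c`.
[cite: LangeRump2018, Thm 7 (proof, case (26))] -/
theorem absErr_le_rootB_add_with {fl : ℚ → ℚ} {c : ℚ} (hc : 0 ≤ c)
    (hval : ∀ t : ℚ, ∃ y : MiniFloat α, y.toRat = fl t)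
    (herr : ∀ a b : MiniFloat α, |a.toRat + b.toRat| ≤ α.maxRat →
      |fl (a.toRat + b.toRat) - (a.toRat + b.toRat)| ≤ c * ufpN α (a.toRat + b.toRat))
    {H : ℚ} (hH : 0 ≤ H) :
    ∀ t : SumTree, TreeInRangeWith α fl t →
      (∀ s : SumTree, TreeInRangeWith α fl s → treeHeight s + 1 ≤ treeHeight t →
          absErr fl s ≤ H * c * absSum s) →
      absErr fl t ≤ c * ufpN α (rootArgWith fl t) + H * c * absSum t
  | .leaf x, _, _ => by
      simp only [absErr, SumTree.localErrors, List.map_nil, List.sum_nil, rootArgWith, ufpN_zero,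
        mul_zero, zero_add, absSum, SumTree.leaves, List.map_cons, List.sum_cons, add_zero]
      exact mul_nonneg (mul_nonneg hH hc) (abs_nonneg x)
  | .node l r, ⟨hl, hr, hrange⟩, hsub => by
      have cl := hsub l hl (by simp only [treeHeight]; omega)
      have cr := hsub r hr (by simp only [treeHeight]; omega)
      obtain ⟨yl, hyl⟩ := exists_toRat_eq_eval_with hval l hl
      obtain ⟨yr, hyr⟩ := exists_toRat_eq_eval_with hval r hr
      have hrange' : |yl.toRat + yr.toRat| ≤ α.maxRat := by rw [hyl, hyr]; exact hrange
      have he : |fl (SumTree.eval fl l + SumTree.eval fl r) - (SumTree.eval fl l + SumTree.eval fl r)|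
          ≤ c * ufpN α (rootArgWith fl (.node l r)) := by
        have := herr yl yr hrange'
        rw [hyl, hyr] at this
        exact this
      rw [absErr_node, absSum_node]
      linarith

/-- THE HEIGHT INDUCTION FOR A GENERAL ROUNDING (Theorem 7 of [LangeRump2018] with `ε = b = c`,
`b_j = c·ufpN(argument)`): for every `η` with `(η+1)²·c ≤ 1`, `H ≤ η`, and every in-range tree of
height `≤ H`: `Σ|e_v| ≤ H·c·Σ|xᵢ| - (η - H)·max(c·ufpN(root arg) - c·Σ|xᵢ|, 0)`.
[cite: LangeRump2018, Thm 7] -/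
theorem langeRump_height_induction_with {fl : ℚ → ℚ} {c : ℚ} (hc : 0 < c)
    (hval : ∀ t : ℚ, ∃ y : MiniFloat α, y.toRat = fl t)
    (herr : ∀ a b : MiniFloat α, |a.toRat + b.toRat| ≤ α.maxRat →
      |fl (a.toRat + b.toRat) - (a.toRat + b.toRat)| ≤ c * ufpN α (a.toRat + b.toRat))
    {η : ℚ} (hη : (η + 1) ^ 2 * c ≤ 1) :
    ∀ H : ℕ, ∀ t : SumTree, TreeInRangeWith α fl t → treeHeight t ≤ H → (H : ℚ) ≤ η →
      absErr fl t ≤ (H : ℚ) * c * absSum t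
        - (η - H) * max (c * ufpN α (rootArgWith fl t) - c * absSum t) 0 := by
  intro H
  induction H using Nat.strong_induction_on with
  | _ H ih =>
    intro t ht hH hHη
    cases t with
    | leaf x =>
        have hT : 0 ≤ absSum (.leaf x) := absSum_nonneg _
        have hmax : max (c * ufpN α (rootArgWith fl (.leaf x)) - c * absSum (.leaf x)) 0 = 0 :=
          max_eq_right (by simp only [rootArgWith, ufpN_zero, mul_zero]; nlinarith)
        rw [hmax, mul_zero, sub_zero]
        simp only [absErr, SumTree.localErrors, List.map_nil, List.sum_nil]
        exact mul_nonneg (mul_nonneg (Nat.cast_nonneg H) hc.le) hT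
    | node p q =>
        obtain ⟨hp, hq, hrange⟩ := ht
        have hH1 : 1 ≤ H := by simp [treeHeight] at hH; omega
        have hpH : treeHeight p ≤ H - 1 := by simp [treeHeight] at hH; omega
        have hqH : treeHeight q ≤ H - 1 := by simp [treeHeight] at hH; omega
        have hcast : ((H - 1 : ℕ) : ℚ) = (H : ℚ) - 1 := by rw [Nat.cast_sub hH1]; simp
        have hH1η : (((H - 1 : ℕ) : ℚ)) ≤ η := by rw [hcast]; linarith
        have ihp := ih (H - 1) (by omega) p hp hpH hH1η
        have ihq := ih (H - 1) (by omega) q hq hqH hH1η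
        rw [hcast] at ihp ihq
        set Dp := absErr fl p
        set Dq := absErr fl q
        set Tp := absSum p
        set Tq := absSum q
        set bp := c * ufpN α (rootArgWith fl p)
        set bq := c * ufpN α (rootArgWith fl q)
        have hDp := absErr_nonneg fl p
        have hDq := absErr_nonneg fl q
        have hTp := absSum_nonneg p
        have hTq := absSum_nonneg q
        have hbp : 0 ≤ bp := mul_nonneg hc.le (ufpN_nonneg α _)
        have hbq : 0 ≤ bq := mul_nonneg hc.le (ufpN_nonneg α _)
        have hηH : 0 ≤ η - ((H : ℚ) - 1) := by linarith
        have wp : Dp ≤ ((H : ℚ) - 1) * c * Tp :=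
          le_trans ihp (sub_le_self _ (mul_nonneg hηH (le_max_right _ _)))
        have wq : Dq ≤ ((H : ℚ) - 1) * c * Tq :=
          le_trans ihq (sub_le_self _ (mul_nonneg hηH (le_max_right _ _)))
        obtain ⟨yl, hyl⟩ := exists_toRat_eq_eval_with hval p hp
        obtain ⟨yr, hyr⟩ := exists_toRat_eq_eval_with hval q hq
        have hrange' : |yl.toRat + yr.toRat| ≤ α.maxRat := by rw [hyl, hyr]; exact hrange
        set y := SumTree.eval fl p + SumTree.eval fl q with hy_def
        set e := |fl y - y| with he_def
        set br := c * ufpN α (rootArgWith fl (.node p q)) with hbr_def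
        have hbr_eq : br = c * ufpN α y := rfl
        have he_br : e ≤ br := by
          have := herr yl yr hrange'
          rw [hyl, hyr] at this; exact this
        have hEnode : absErr fl (.node p q) = Dp + Dq + e := absErr_node _ _ _
        have hTnode : absSum (.node p q) = Tp + Tq := absSum_node _ _
        have h28 : br - c * (Tp + Tq) ≤ c * (Dp + Dq) := by
          have h1 : ufpN α y ≤ |y| := ufpN_le_abs y
          have h2 : |y| ≤ |SumTree.exact p + SumTree.exact q| + Dp + Dq := by
            have : y = (SumTree.exact p + SumTree.exact q)
                + ((SumTree.eval fl p - SumTree.exact p) + (SumTree.eval fl q - SumTree.exact q)) := by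
              rw [hy_def]; ring
            rw [this]
            refine le_trans (abs_add_le _ _) ?_
            have h3 := abs_add_le (SumTree.eval fl p - SumTree.exact p)
              (SumTree.eval fl q - SumTree.exact q)
            have h4 := abs_eval_sub_exact_le fl p
            have h5 := abs_eval_sub_exact_le fl q
            linarith
          have h3 : |SumTree.exact p + SumTree.exact q| ≤ Tp + Tq := by
            rw [← absSum_node]; exact abs_exact_le_absSum (.node p q)
          have h4 : ufpN α y ≤ Tp + Tq + (Dp + Dq) := by linarith
          have h5 := mul_le_mul_of_nonneg_left h4 hc.le
          rw [hbr_eq]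
          linarith
        rw [hEnode, hTnode]
        by_cases hc1 : br ≤ c * (Tp + Tq)
        · have hmax : max (br - c * (Tp + Tq)) 0 = 0 := max_eq_right (by linarith)
          rw [hmax, mul_zero, sub_zero]
          linarith
        · have hX : 0 < br - c * (Tp + Tq) := by linarith
          have hmax : max (br - c * (Tp + Tq)) 0 = br - c * (Tp + Tq) := max_eq_left hX.le
          rw [hmax]
          by_cases hc2 : br ≤ bp + bq
          · have m1 : bp - c * Tp ≤ max (bp - c * Tp) 0 := le_max_left _ _
            have m2 : bq - c * Tq ≤ max (bq - c * Tq) 0 := le_max_left _ _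
            have key : Dp + Dq ≤ ((H : ℚ) - 1) * c * (Tp + Tq)
                - (η - ((H : ℚ) - 1)) * (br - c * (Tp + Tq)) := by
              have : (η - ((H : ℚ) - 1)) * (br - c * (Tp + Tq))
                  ≤ (η - ((H : ℚ) - 1)) * (max (bp - c * Tp) 0 + max (bq - c * Tq) 0) :=
                mul_le_mul_of_nonneg_left (by linarith) hηH
              linarith
            linarith
          · have hc2' : bp + bq < br := not_le.mp hc2
            have hDpq : br - c * (Tp + Tq) ≤ ((H : ℚ) - 1) * c * c * (Tp + Tq) := by
              have := mul_le_mul_of_nonneg_left (add_le_add wp wq) hc.le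
              linarith
            have hH2 : 2 ≤ H := by
              by_contra hlt
              have hH1' : H = 1 := by omega
              subst hH1'
              simp at hDpq
              linarith
            have hcast2 : ((H - 2 : ℕ) : ℚ) = (H : ℚ) - 2 := by rw [Nat.cast_sub hH2]; simp
            have two : ∀ s : SumTree, TreeInRangeWith α fl s → treeHeight s ≤ H - 1 →
                absErr fl s ≤ c * ufpN α (rootArgWith fl s) + ((H : ℚ) - 2) * c * absSum s := by
              intro s hs hsh
              refine absErr_le_rootB_add_with hc.le hval herr (by linarith) s hs (fun s' hs' hh' => ?_)
              have := ih (H - 2) (by omega) s' hs' (by omega) (by rw [hcast2]; linarith)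
              rw [hcast2] at this
              exact le_trans this (sub_le_self _ (mul_nonneg (by linarith) (le_max_right _ _)))
            have tp := two p hp hpH
            have tq := two q hq hqH
            have h27 : bp + bq ≤ 3 / 4 * br := by
              have hlt : ufpN α (rootArgWith fl p) + ufpN α (rootArgWith fl q) < ufpN α y := by
                have h' : c * (ufpN α (rootArgWith fl p) + ufpN α (rootArgWith fl q))
                    < c * ufpN α y := by
                  rw [mul_add]; exact hc2'
                exact lt_of_mul_lt_mul_left h' hc.le
              have := mul_le_mul_of_nonneg_left (ufpN_add_ufpN_le_of_lt hlt) hc.le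
              rw [hbr_eq]
              change c * ufpN α (rootArgWith fl p) + c * ufpN α (rootArgWith fl q) ≤ _
              linarith
            have amgm : (η - H + 2) * ((H : ℚ) - 1) * c ≤ 1 / 4 := by
              have h0 : (η + 1) ^ 2 / 4 - (η - H + 2) * ((H : ℚ) - 1)
                  = ((η - H + 2) - ((H : ℚ) - 1)) ^ 2 / 4 := by ring
              have h1 : (η - H + 2) * ((H : ℚ) - 1) ≤ (η + 1) ^ 2 / 4 := by
                have := sq_nonneg ((η - H + 2) - ((H : ℚ) - 1))
                linarith
              calc (η - H + 2) * ((H : ℚ) - 1) * c ≤ (η + 1) ^ 2 / 4 * c :=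
                    mul_le_mul_of_nonneg_right h1 hc.le
                _ ≤ 1 / 4 := by linarith
            have hT0 : 0 ≤ Tp + Tq := add_nonneg hTp hTq
            have hfin : (7 / 4 + η - H) * (br - c * (Tp + Tq)) ≤ c * (Tp + Tq) / 4 := by
              have hcη : 0 ≤ 7 / 4 + η - (H : ℚ) := by linarith
              have hH1' : (1 : ℚ) ≤ H := by exact_mod_cast hH1
              have hHc : (0 : ℚ) ≤ ((H : ℚ) - 1) * c := mul_nonneg (by linarith) hc.le
              calc (7 / 4 + η - H) * (br - c * (Tp + Tq))
                  ≤ (7 / 4 + η - H) * (((H : ℚ) - 1) * c * c * (Tp + Tq)) :=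
                    mul_le_mul_of_nonneg_left hDpq hcη
                _ = ((η - H + 7 / 4) * (((H : ℚ) - 1) * c)) * (c * (Tp + Tq)) := by ring
                _ ≤ ((η - H + 2) * (((H : ℚ) - 1) * c)) * (c * (Tp + Tq)) := by
                    apply mul_le_mul_of_nonneg_right _ (mul_nonneg hc.le hT0)
                    exact mul_le_mul_of_nonneg_right (by linarith) hHc
                _ ≤ (1 / 4) * (c * (Tp + Tq)) := by
                    apply mul_le_mul_of_nonneg_right _ (mul_nonneg hc.le hT0)
                    have : (η - H + 2) * (((H : ℚ) - 1) * c) = (η - H + 2) * ((H : ℚ) - 1) * c := by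
                      ring
                    rw [this]; exact amgm
                _ = c * (Tp + Tq) / 4 := by ring
            have hsum : Dp + Dq + e ≤ br + (bp + bq) + ((H : ℚ) - 2) * c * (Tp + Tq) := by
              have : Dp + Dq ≤ bp + ((H : ℚ) - 2) * c * Tp + (bq + ((H : ℚ) - 2) * c * Tq) :=
                add_le_add tp tq
              linarith
            linarith

/-- HEIGHT BOUND FOR A GENERAL ROUNDING: a node map `fl` landing in `F_α` whose in-range additions
err by `≤ c·ufpN(argument)`; then every in-range evaluation tree of height `h` with `(h+1)²·c ≤ 1`
has `Σ|e_v| ≤ h·c·Σ|xᵢ|`. [cite: LangeRump2018, Thm 7] -/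
theorem absErr_le_height_with {fl : ℚ → ℚ} {c : ℚ} (hc : 0 < c)
    (hval : ∀ t : ℚ, ∃ y : MiniFloat α, y.toRat = fl t)
    (herr : ∀ a b : MiniFloat α, |a.toRat + b.toRat| ≤ α.maxRat →
      |fl (a.toRat + b.toRat) - (a.toRat + b.toRat)| ≤ c * ufpN α (a.toRat + b.toRat))
    (t : SumTree) (ht : TreeInRangeWith α fl t) (hh : ((treeHeight t : ℚ) + 1) ^ 2 * c ≤ 1) :
    absErr fl t ≤ (treeHeight t : ℚ) * c * absSum t := by
  have := langeRump_height_induction_with hc hval herr (η := treeHeight t) hh (treeHeight t) t ht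
    le_rfl le_rfl
  simpa using this

/-! ### Faithful roundings of the formats err by less than one ulp: `c = 2u` -/

/-- `2u · ufpN(x) = 2^s · quantum`, the spacing of the binade of `|x| ≥ 2^(m+1)·quantum`. [folklore] -/
theorem two_mul_unitRoundoff_mul_ufpN {x : ℚ} (hx : ¬ |x| < 2 ^ (α.manBits + 1) * α.quantum) :
    2 * α.unitRoundoff * ufpN α x = 2 ^ α.shift ⌊|x| / α.quantum⌋.toNat * α.quantum := by
  unfold ufpN; rw [if_neg hx, Format.unitRoundoff_eq, pow_add, pow_succ]; field_simp; ring

/-- Round-down fixes values. [folklore] -/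
theorem toRat_roundDown_toRat (y : MiniFloat α) : (roundDown α y.toRat).toRat = y.toRat :=
  le_antisymm (toRat_roundDown_le y.abs_toRat_le_maxRat)
    (toRat_le_roundDown y.abs_toRat_le_maxRat y le_rfl)

/-- Round-up fixes values. [folklore] -/
theorem toRat_roundUp_toRat (y : MiniFloat α) : (roundUp α y.toRat).toRat = y.toRat :=
  le_antisymm (roundUp_le_toRat y.abs_toRat_le_maxRat y le_rfl)
    (le_toRat_roundUp y.abs_toRat_le_maxRat)

/-- A small sum of two values (below `2^(m+1)` quanta, `emaxCode ≥ 2`) is a value. [folklore] -/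
theorem exists_toRat_eq_add_of_small (hα : 2 ≤ α.emaxCode) (a b : MiniFloat α)
    (h : |a.toRat + b.toRat| < 2 ^ (α.manBits + 1) * α.quantum) :
    ∃ y : MiniFloat α, y.toRat = a.toRat + b.toRat := by
  have h0 := errAdd_eq_zero_of_small hα a b h
  unfold errAdd at h0
  exact ⟨roundNE α (a.toRat + b.toRat), by linarith⟩

/-- ROUND-DOWN errs by at most `2u·ufpN` on in-range sums of two values. [folklore] -/
theorem abs_err_roundDown_add_le (hα : 2 ≤ α.emaxCode) (a b : MiniFloat α)
    (h : |a.toRat + b.toRat| ≤ α.maxRat) :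
    |(roundDown α (a.toRat + b.toRat)).toRat - (a.toRat + b.toRat)|
      ≤ 2 * α.unitRoundoff * ufpN α (a.toRat + b.toRat) := by
  by_cases hsmall : |a.toRat + b.toRat| < 2 ^ (α.manBits + 1) * α.quantum
  · obtain ⟨y, hy⟩ := exists_toRat_eq_add_of_small hα a b hsmall
    rw [← hy, toRat_roundDown_toRat, sub_self, abs_zero]
    exact mul_nonneg (mul_nonneg (by norm_num) α.unitRoundoff_pos.le) (ufpN_nonneg α _)
  · rw [two_mul_unitRoundoff_mul_ufpN hsmall]
    have h1 := sub_roundDown_lt (φ := α) h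
    have h2 := toRat_roundDown_le (φ := α) h
    rw [abs_of_nonpos (by linarith)]
    linarith

/-- ROUND-UP errs by at most `2u·ufpN` on in-range sums of two values. [folklore] -/
theorem abs_err_roundUp_add_le (hα : 2 ≤ α.emaxCode) (a b : MiniFloat α)
    (h : |a.toRat + b.toRat| ≤ α.maxRat) :
    |(roundUp α (a.toRat + b.toRat)).toRat - (a.toRat + b.toRat)|
      ≤ 2 * α.unitRoundoff * ufpN α (a.toRat + b.toRat) := by
  by_cases hsmall : |a.toRat + b.toRat| < 2 ^ (α.manBits + 1) * α.quantum
  · obtain ⟨y, hy⟩ := exists_toRat_eq_add_of_small hα a b hsmall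
    rw [← hy, toRat_roundUp_toRat, sub_self, abs_zero]
    exact mul_nonneg (mul_nonneg (by norm_num) α.unitRoundoff_pos.le) (ufpN_nonneg α _)
  · rw [two_mul_unitRoundoff_mul_ufpN hsmall]
    have h1 := roundUp_sub_lt (φ := α) h
    have h2 := le_toRat_roundUp (φ := α) h
    rw [abs_of_nonneg (by linarith)]
    linarith

/-- The faithful height restriction for the accumulators: `(h+1)²·2u ≤ 1` for `h ≤ 31`
(binary16), `10` (bfloat16), `2895` (binary32). [folklore] -/
theorem faithful_height_restrictions :
    ((31 : ℚ) + 1) ^ 2 * (2 * Format.Binary16.unitRoundoff) ≤ 1 ∧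
    ((10 : ℚ) + 1) ^ 2 * (2 * Format.BFloat16.unitRoundoff) ≤ 1 ∧
    ((2895 : ℚ) + 1) ^ 2 * (2 * Format.Binary32.unitRoundoff) ≤ 1 := by
  simp only [Format.unitRoundoff_eq]
  norm_num [Format.Binary16, Format.BFloat16, Format.Binary32]

/-- ROUND-DOWN ACCUMULATION, ANY ORDER: leaves in `F_α` (`emaxCode ≥ 2`), nodes in range, height
`h` with `(h+1)²·2u ≤ 1` ⟹ `|ŝ - s| ≤ 2h·u·Σ|xᵢ|`. [cite: LangeRump2018, Prop 3 (faithful case)] -/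
theorem abs_eval_rd_sub_exact_le_height (hα : 2 ≤ α.emaxCode) (t : SumTree)
    (ht : TreeInRangeWith α (fun s => (roundDown α s).toRat) t)
    (hh : ((treeHeight t : ℚ) + 1) ^ 2 * (2 * α.unitRoundoff) ≤ 1) :
    |SumTree.eval (fun s => (roundDown α s).toRat) t - SumTree.exact t|
      ≤ (treeHeight t : ℚ) * (2 * α.unitRoundoff) * absSum t :=
  le_trans (abs_eval_sub_exact_le _ t)
    (absErr_le_height_with (by linarith [α.unitRoundoff_pos]) (fun s => ⟨roundDown α s, rfl⟩)
      (fun a b h => abs_err_roundDown_add_le hα a b h) t ht hh)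

/-- ROUND-UP ACCUMULATION, ANY ORDER: same bound. [cite: LangeRump2018, Prop 3 (faithful case)] -/
theorem abs_eval_ru_sub_exact_le_height (hα : 2 ≤ α.emaxCode) (t : SumTree)
    (ht : TreeInRangeWith α (fun s => (roundUp α s).toRat) t)
    (hh : ((treeHeight t : ℚ) + 1) ^ 2 * (2 * α.unitRoundoff) ≤ 1) :
    |SumTree.eval (fun s => (roundUp α s).toRat) t - SumTree.exact t|
      ≤ (treeHeight t : ℚ) * (2 * α.unitRoundoff) * absSum t :=
  le_trans (abs_eval_sub_exact_le _ t)
    (absErr_le_height_with (by linarith [α.unitRoundoff_pos]) (fun s => ⟨roundUp α s, rfl⟩)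
      (fun a b h => abs_err_roundUp_add_le hα a b h) t ht hh)

/-- ANY FAITHFUL SELECTION: a node map choosing, for each argument, either the round-down or the
round-up value (e.g. truncation; a realisation of stochastic rounding viewed as a map) obeys the
same `2h·u` height bound in any order. [cite: LangeRump2018, Prop 3 (faithful case)] -/
theorem abs_eval_faithful_sub_exact_le_height (hα : 2 ≤ α.emaxCode) (fl : ℚ → ℚ)
    (hfl : ∀ s : ℚ, fl s = (roundDown α s).toRat ∨ fl s = (roundUp α s).toRat) (t : SumTree)
    (ht : TreeInRangeWith α fl t) (hh : ((treeHeight t : ℚ) + 1) ^ 2 * (2 * α.unitRoundoff) ≤ 1) :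
    |SumTree.eval fl t - SumTree.exact t| ≤ (treeHeight t : ℚ) * (2 * α.unitRoundoff) * absSum t := by
  refine le_trans (abs_eval_sub_exact_le _ t)
    (absErr_le_height_with (by linarith [α.unitRoundoff_pos]) (fun s => ?_) (fun a b h => ?_) t ht hh)
  · rcases hfl s with hs | hs
    · exact ⟨roundDown α s, hs.symm⟩
    · exact ⟨roundUp α s, hs.symm⟩
  · rcases hfl (a.toRat + b.toRat) with hs | hs <;> rw [hs]
    · exact abs_err_roundDown_add_le hα a b h
    · exact abs_err_roundUp_add_le hα a b h

end MiniFloat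

end Literature.ComputerArithmetic.FloatingPoint
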